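import Summits.CriticalPhenomena.Ising3D.ExclusionSentences

/-!
# The `GFD` rational family (Kaupužs 2001) and the LeClair 2006 pair in kernel form — NAMED-late-3

SCOPE.md §3 (pub-ising3x, recog-1), quarantined supplement `HOME/frozen/FAMILIES-v1-NAMED-late-3.json`
(exclusion-catalogue targets only, never scored as recognitions; FAMILIES-v1 `b39f709f…` unchanged).
HONEST FRAMING: lottery ticket; floor = tightest certified 3D Ising CFT bounds; no exact-solution
claim without a proof.

Two closed-form proposals in print that the frozen `NAMED` list of `ExclusionSentences.lean` does not
carry:

* **`GFD`** — J. Kaupužs, *Ann. Phys. (Leipzig)* **10** (2001) 299 (= arXiv:cond-mat/0004255),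
  eq. (21): "possible exact values of critical exponents" of the `n`-vector model in `d < 4`
  dimensions, `γ = (d + 2j + 4m)/(d(1+m+j) − 2j)`, `ν = (2(1+m) + j)/(d(1+m+j) − 2j)`, `m ≥ 1`
  natural, `j ≥ −m` integer (the author's `n = 1` selection `(m, j) = (3, 0)` gives `γ = 5/4`,
  `ν = 2/3`, i.e. the pair `(9/16, 3/2)` already in `namedPairs`).  Under the CFT dictionary
  `Δ_σ = (d − 2 + η)/2`, `η = 2 − γ/ν`, `Δ_ε = d − 1/ν` and the bijection `K = 2m + j + 2 ≥ 3`,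
  `1 ≤ L = m + j + 1 ≤ K − 2` (`gfdPair3_eq_kaupuzs`, `gfdPair2_eq_kaupuzs` below) the whole table is
  `d = 3`: `(Δ_σ, Δ_ε) = ((K+1)/(2K), (K+L)/K)` (`η = 1/K`) and `d = 2`: `(1/K, 2L/K)`
  (`(K, L) = (8, 4)` = Onsager's `(1/8, 1)`).  A two-parameter RATIONAL table of Kac type proposed in
  print for the 3D Ising exponents — registered here as a family of kind `DeltaPair` with its own
  kernel sentence, exactly like `KACJ` (`ExclusionSentencesKacPair.lean`): every single value is a
  `RAT` member (denominator `≤ 2K`), the `Δ_ε`-projection is (almost) all of `ℚ ∩ (1, 2)`, so only the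
  JOINT sentence has content at phase-1 box widths.
* **LeClair 2006** — A. LeClair, "3D Ising and other models from symplectic fermions",
  arXiv:cond-mat/0610817 (abstract; table of §3): the `Sp(−2)₃` symplectic-fermion fixed point at
  lowest order gives for 3D Ising `ν = 5/8`, `β = 13/40`, i.e. `(Δ_σ, Δ_ε) = (β/ν, 3 − 1/ν) =
  (13/25, 7/5)`; WITHDRAWN by LeClair–Neubert, *JHEP* **10** (2007) 027 (arXiv:0705.4657, §5: "the
  next-order corrections … spoil this agreement").  `Δ_ε = 7/5` is already in `namedEps`;
  `Δ_σ = 13/25` is new and lies INSIDE the cell's window `W = [0.505, 0.535] × [1.2, 1.6]`.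

Contents of THIS file: `gfdPair3/gfdPair2`, `gfdFamily3/gfdFamily2`, the dictionary lemmas
`gfdPair3_eq_kaupuzs` / `gfdPair2_eq_kaupuzs`, the integer checkers `gfdExcluded3 Kmax a b c d ex` /
`gfdExcluded2 Kmax a b c d ex` (finite because `Δ_σ = 1/2 + 1/(2K)` resp. `1/K` accumulates only at the
excluded face: `a > 1/2` resp. `a > 0` bounds `K ≤ Kmax`, and the checker VERIFIES the supplied `Kmax`),
their soundness, the bridge `pair_not_gfd_of_isingEnclosure` and rule R3 `gfd3_listed_of_subbox`.
The 2D control, a synthetic validation box and the LeClair data with their enclosure corollaries are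
in `ExclusionSentencesGFDControl.lean`.  Python twin (two routes that must agree):
`HOME/pub-ising3x-recog-1/lean/tools/gfd_exceptions.py`.  Hygiene: `Bool` checkers + soundness,
`decide +kernel` on closed numerals only, no `native_decide`, no new axioms, no 3D digit.
-/

namespace Summit.CriticalPhenomena.Ising3D

open Literature.MathematicalPhysics.QuantumFieldTheory.ConformalBootstrap3D

/-! ### The family and the dictionary to Kaupužs' `(m, j)` -/

/-- `GFD` member in `d = 3`: `(Δ_σ, Δ_ε) = ((K+1)/(2K), (K+L)/K) = (1/2 + 1/(2K), 1 + L/K)`. -/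
def gfdPair3 (K L : ℕ) : ℚ × ℚ := (((K : ℚ) + 1) / (2 * K), ((K : ℚ) + L) / K)

/-- `GFD` member in `d = 2`: `(Δ_σ, Δ_ε) = (1/K, 2L/K)`. -/
def gfdPair2 (K L : ℕ) : ℚ × ℚ := (1 / (K : ℚ), 2 * (L : ℚ) / K)

/-- The `d = 3` table: `K ≥ 3`, `1 ≤ L ≤ K − 2` (⇔ Kaupužs' `m = K − L − 1 ≥ 1`, `j = 2L − K ≥ −m`). -/
def gfdFamily3 : Set (ℚ × ℚ) := {v | ∃ K L : ℕ, 3 ≤ K ∧ 1 ≤ L ∧ L + 2 ≤ K ∧ v = gfdPair3 K L}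

/-- The `d = 2` table (same index set). -/
def gfdFamily2 : Set (ℚ × ℚ) := {v | ∃ K L : ℕ, 3 ≤ K ∧ 1 ≤ L ∧ L + 2 ≤ K ∧ v = gfdPair2 K L}

/-- Kaupužs' eq. (21), susceptibility exponent `γ(d; m, j) = (d + 2j + 4m)/(d(1+m+j) − 2j)`. -/
def kaupuzsGamma (d m j : ℚ) : ℚ := (d + 2 * j + 4 * m) / (d * (1 + m + j) - 2 * j)

/-- Kaupužs' eq. (21), correlation-length exponent `ν(d; m, j) = (2(1+m) + j)/(d(1+m+j) − 2j)`. -/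
def kaupuzsNu (d m j : ℚ) : ℚ := (2 * (1 + m) + j) / (d * (1 + m + j) - 2 * j)

/-- The CFT dictionary `(Δ_σ, Δ_ε) = ((d − 2 + η)/2, d − 1/ν)` with `η = 2 − γ/ν`. -/
def exponentsToDims (d γ ν : ℚ) : ℚ × ℚ := ((d - 2 + (2 - γ / ν)) / 2, d - 1 / ν)

/-- **Dictionary, `d = 3`.** For integers `m ≥ 1`, `j ≥ −m`, Kaupužs' `(γ, ν)` correspond to the
dimensions `gfdPair3 K L` with `K = 2m + j + 2`, `L = m + j + 1`. -/
theorem gfdPair3_eq_kaupuzs (m j : ℤ) (hm : 1 ≤ m) (hj : -m ≤ j) (K L : ℕ)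
    (hK : (K : ℤ) = 2 * m + j + 2) (hL : (L : ℤ) = m + j + 1) :
    exponentsToDims 3 (kaupuzsGamma 3 m j) (kaupuzsNu 3 m j) = gfdPair3 K L := by
  have hK' : (K : ℚ) = 2 * m + j + 2 := by exact_mod_cast hK
  have hL' : (L : ℚ) = m + j + 1 := by exact_mod_cast hL
  have hm' : (1 : ℚ) ≤ m := by exact_mod_cast hm
  have hj' : -(m : ℚ) ≤ j := by exact_mod_cast hj
  have h1 : (3 * (1 + (m : ℚ) + j) - 2 * j) ≠ 0 := by intro h; linarith
  have h2 : (2 * (1 + (m : ℚ)) + j) ≠ 0 := by intro h; linarith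
  have h3 : (2 * (m : ℚ) + j + 2) ≠ 0 := by intro h; linarith
  have h4 : (1 + (m : ℚ)) ≠ 0 := by intro h; linarith
  simp only [exponentsToDims, kaupuzsGamma, kaupuzsNu, gfdPair3, hK', hL', Prod.mk.injEq]
  constructor
  · field_simp
    ring
  · field_simp
    ring

/-- **Dictionary, `d = 2`.** Same correspondence with `gfdPair2`; in particular `(m, j) = (3, 0)`
reproduces Onsager's `(1/8, 1)` (`gfdPair2_onsager`). -/
theorem gfdPair2_eq_kaupuzs (m j : ℤ) (hm : 1 ≤ m) (hj : -m ≤ j) (K L : ℕ)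
    (hK : (K : ℤ) = 2 * m + j + 2) (hL : (L : ℤ) = m + j + 1) :
    exponentsToDims 2 (kaupuzsGamma 2 m j) (kaupuzsNu 2 m j) = gfdPair2 K L := by
  have hK' : (K : ℚ) = 2 * m + j + 2 := by exact_mod_cast hK
  have hL' : (L : ℚ) = m + j + 1 := by exact_mod_cast hL
  have hm' : (1 : ℚ) ≤ m := by exact_mod_cast hm
  have hj' : -(m : ℚ) ≤ j := by exact_mod_cast hj
  have h1 : (2 * (1 + (m : ℚ) + j) - 2 * j) ≠ 0 := by intro h; linarith
  have h2 : (2 * (1 + (m : ℚ)) + j) ≠ 0 := by intro h; linarith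
  have h3 : (2 * (m : ℚ) + j + 2) ≠ 0 := by intro h; linarith
  have h4 : (1 + (m : ℚ)) ≠ 0 := by intro h; linarith
  have hq : kaupuzsGamma 2 m j / kaupuzsNu 2 m j = (2 + 2 * j + 4 * m) / (2 * (1 + m) + j) := by
    unfold kaupuzsGamma kaupuzsNu
    rw [div_div_div_cancel_right₀ h1]
  have hn : 1 / kaupuzsNu 2 m j = (2 * (1 + m + j) - 2 * j) / (2 * (1 + m) + j) := by
    unfold kaupuzsNu
    rw [one_div_div]
  simp only [exponentsToDims, hq, hn, gfdPair2, hK', hL', Prod.mk.injEq]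
  constructor
  · field_simp
    ring
  · field_simp
    ring

/-- The author's `n = 1` selection `(m, j) = (3, 0)`, i.e. `(K, L) = (8, 4)`: in `d = 2` Onsager's
`(Δ_σ, Δ_ε) = (1/8, 1)`. -/
theorem gfdPair2_onsager : gfdPair2 8 4 = (1 / 8, 1) := by
  norm_num [gfdPair2]

/-- … and in `d = 3` the Zhang–Kaupužs pair `(9/16, 3/2)`, the first entry of `namedPairs`. -/
theorem gfdPair3_selection : gfdPair3 8 4 = (9 / 16, 3 / 2) ∧ ((9 / 16 : ℚ), (3 / 2 : ℚ)) ∈ namedPairs := by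
  refine ⟨by norm_num [gfdPair3], by simp [namedPairs]⟩

/-- Every `d = 3` member has `1/2 < Δ_σ` and `1 < Δ_ε < 2`: none is refuted by the typed axioms alone
(unitarity A1 is `1/2 ≤ Δ_σ`); each needs a certificate. -/
theorem gfdPair3_bounds {K L : ℕ} (hK : 3 ≤ K) (hL : 1 ≤ L) (hLK : L + 2 ≤ K) :
    1 / 2 < (gfdPair3 K L).1 ∧ 1 < (gfdPair3 K L).2 ∧ (gfdPair3 K L).2 < 2 := by
  have hKq : (3 : ℚ) ≤ K := by exact_mod_cast hK
  have hLq : (1 : ℚ) ≤ L := by exact_mod_cast hL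
  have hLKq : (L : ℚ) + 2 ≤ K := by exact_mod_cast hLK
  have hKpos : (0 : ℚ) < K := by linarith
  simp only [gfdPair3]
  refine ⟨?_, ?_, ?_⟩
  · rw [lt_div_iff₀ (by linarith)]; linarith
  · rw [lt_div_iff₀ hKpos]; linarith
  · rw [div_lt_iff₀ hKpos]; linarith

/-! ### The checkers (integer cores) -/

/-- Integer core, `d = 3`: box `[an/ad, bn/bd] × [cn/cd, dn/dd]`; every `(K, L)`, `3 ≤ K ≤ Kmax`,
`1 ≤ L ≤ K − 2`, whose pair lies in the box must be listed in `ex`. -/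
def gfdCore3 (Kmax : ℕ) (an : ℤ) (ad : ℕ) (bn : ℤ) (bd : ℕ) (cn : ℤ) (cd : ℕ) (dn : ℤ) (dd : ℕ)
    (ex : List (ℕ × ℕ)) : Bool :=
  (List.range' 3 (Kmax - 2)).all fun K =>
    (List.range' 1 (K - 2)).all fun L =>
      decide ((K, L) ∈ ex) ||
        !(decide (an * ((2 * K : ℕ) : ℤ) ≤ ((K + 1 : ℕ) : ℤ) * (ad : ℤ)) &&
          decide (((K + 1 : ℕ) : ℤ) * (bd : ℤ) ≤ bn * ((2 * K : ℕ) : ℤ)) &&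
          decide (cn * ((K : ℕ) : ℤ) ≤ ((K + L : ℕ) : ℤ) * (cd : ℤ)) &&
          decide (((K + L : ℕ) : ℤ) * (dd : ℤ) ≤ dn * ((K : ℕ) : ℤ)))

/-- `gfdExcluded3 Kmax a b c d ex = true` certifies: (i) `(Kmax + 2)/(2(Kmax + 1)) < a`, so every member
with `K > Kmax` has `Δ_σ < a`; (ii) every member with `K ≤ Kmax` inside `[a, b] × [c, d]` is listed. -/
def gfdExcluded3 (Kmax : ℕ) (a b c d : ℚ) (ex : List (ℕ × ℕ)) : Bool :=
  decide (((Kmax + 2 : ℕ) : ℤ) * (a.den : ℤ) < a.num * ((2 * (Kmax + 1) : ℕ) : ℤ)) &&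
    gfdCore3 Kmax a.num a.den b.num b.den c.num c.den d.num d.den ex

/-- Integer core, `d = 2`: pairs `(1/K, 2L/K)`. -/
def gfdCore2 (Kmax : ℕ) (an : ℤ) (ad : ℕ) (bn : ℤ) (bd : ℕ) (cn : ℤ) (cd : ℕ) (dn : ℤ) (dd : ℕ)
    (ex : List (ℕ × ℕ)) : Bool :=
  (List.range' 3 (Kmax - 2)).all fun K =>
    (List.range' 1 (K - 2)).all fun L =>
      decide ((K, L) ∈ ex) ||
        !(decide (an * ((K : ℕ) : ℤ) ≤ ((1 : ℕ) : ℤ) * (ad : ℤ)) &&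
          decide (((1 : ℕ) : ℤ) * (bd : ℤ) ≤ bn * ((K : ℕ) : ℤ)) &&
          decide (cn * ((K : ℕ) : ℤ) ≤ ((2 * L : ℕ) : ℤ) * (cd : ℤ)) &&
          decide (((2 * L : ℕ) : ℤ) * (dd : ℤ) ≤ dn * ((K : ℕ) : ℤ)))

/-- `gfdExcluded2 Kmax a b c d ex = true` certifies: (i) `1/(Kmax + 1) < a`; (ii) every `d = 2` member
with `K ≤ Kmax` inside `[a, b] × [c, d]` is listed. -/
def gfdExcluded2 (Kmax : ℕ) (a b c d : ℚ) (ex : List (ℕ × ℕ)) : Bool :=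
  decide ((a.den : ℤ) < a.num * ((Kmax + 1 : ℕ) : ℤ)) &&
    gfdCore2 Kmax a.num a.den b.num b.den c.num c.den d.num d.den ex

/-! ### Soundness -/

/-- The inner Boolean of the cores: listed, or not in the box. -/
private theorem listed_of_orNot {P : Prop} [Decidable P] {b₁ b₂ b₃ b₄ : Bool}
    (h : (decide P || !(b₁ && b₂ && b₃ && b₄)) = true) (h₁ : b₁ = true) (h₂ : b₂ = true)
    (h₃ : b₃ = true) (h₄ : b₄ = true) : P := by
  subst h₁; subst h₂; subst h₃; subst h₄
  simpa using h

/-- `Δ_σ = (K+1)/(2K)` is decreasing in `K`. -/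
private theorem sigma3_antitone {K K' : ℕ} (hK : 0 < K') (hKK : K' ≤ K) :
    ((K : ℚ) + 1) / (2 * K) ≤ ((K' : ℚ) + 1) / (2 * K') := by
  have hK'q : (0 : ℚ) < K' := by exact_mod_cast hK
  have hKq : (K' : ℚ) ≤ K := by exact_mod_cast hKK
  rw [div_le_div_iff₀ (by linarith) (by linarith)]
  nlinarith

/-- **Soundness, `d = 3`.** If `gfdExcluded3 Kmax a b c d ex = true` then every index pair `(K, L)` of
the table whose dimensions `gfdPair3 K L` lie in `[a, b] × [c, d]` belongs to `ex`. -/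
theorem gfdExcluded3_sound {Kmax : ℕ} {a b c d : ℚ} {ex : List (ℕ × ℕ)}
    (h : gfdExcluded3 Kmax a b c d ex = true) {K L : ℕ} (hK : 3 ≤ K) (hL : 1 ≤ L) (hLK : L + 2 ≤ K)
    (ha : a ≤ (gfdPair3 K L).1) (hb : (gfdPair3 K L).1 ≤ b) (hc : c ≤ (gfdPair3 K L).2)
    (hd : (gfdPair3 K L).2 ≤ d) : (K, L) ∈ ex := by
  unfold gfdExcluded3 at h
  rw [Bool.and_eq_true, decide_eq_true_eq] at h
  obtain ⟨hKm, hcore⟩ := h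
  have hD1 : 0 < 2 * K := by omega
  have hD2 : 0 < K := by omega
  have e1 : (gfdPair3 K L).1 = (((K + 1 : ℕ) : ℤ) : ℚ) / ((2 * K : ℕ) : ℚ) := by
    simp only [gfdPair3]; push_cast; ring
  have e2 : (gfdPair3 K L).2 = (((K + L : ℕ) : ℤ) : ℚ) / ((K : ℕ) : ℚ) := by
    simp only [gfdPair3]; push_cast; ring
  -- `K ≤ Kmax`: otherwise `Δ_σ ≤ (Kmax+2)/(2(Kmax+1)) < a`.
  have hKle : K ≤ Kmax := by
    by_contra hlt
    have hlt' : Kmax + 1 ≤ K := by omega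
    have hmono : ((K : ℚ) + 1) / (2 * K) ≤
        (((Kmax + 1 : ℕ) : ℚ) + 1) / (2 * ((Kmax + 1 : ℕ) : ℚ)) :=
      sigma3_antitone (by omega) hlt'
    have hpos : 0 < 2 * (Kmax + 1) := by omega
    have ha' : (((Kmax + 2 : ℕ) : ℤ) : ℚ) / ((2 * (Kmax + 1) : ℕ) : ℚ) < a := by
      rw [← not_le, le_intDiv_iff a _ hpos]
      exact not_le.mpr hKm
    have e : (((Kmax + 1 : ℕ) : ℚ) + 1) / (2 * ((Kmax + 1 : ℕ) : ℚ)) =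
        (((Kmax + 2 : ℕ) : ℤ) : ℚ) / ((2 * (Kmax + 1) : ℕ) : ℚ) := by
      push_cast; ring
    rw [e] at hmono
    have hlt2 : (gfdPair3 K L).1 < a := lt_of_le_of_lt hmono ha'
    exact absurd ha (not_le.mpr hlt2)
  unfold gfdCore3 at hcore
  have h1 := List.all_eq_true.mp hcore K (List.mem_range'_1.mpr ⟨hK, by omega⟩)
  have h2 := List.all_eq_true.mp h1 L (List.mem_range'_1.mpr ⟨hL, by omega⟩)
  rw [e1] at ha hb
  rw [e2] at hc hd
  exact listed_of_orNot h2 (decide_eq_true ((le_intDiv_iff a _ hD1).mp ha))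
    (decide_eq_true ((intDiv_le_iff b _ hD1).mp hb)) (decide_eq_true ((le_intDiv_iff c _ hD2).mp hc))
    (decide_eq_true ((intDiv_le_iff d _ hD2).mp hd))

/-- Family form of the `d = 3` soundness: a member of `gfdFamily3` in the box is the pair of a listed
index. -/
theorem mem_map_of_gfdExcluded3 {Kmax : ℕ} {a b c d : ℚ} {ex : List (ℕ × ℕ)}
    (h : gfdExcluded3 Kmax a b c d ex = true) {v : ℚ × ℚ} (hv : v ∈ gfdFamily3) (ha : a ≤ v.1)
    (hb : v.1 ≤ b) (hc : c ≤ v.2) (hd : v.2 ≤ d) : v ∈ ex.map fun e => gfdPair3 e.1 e.2 := by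
  obtain ⟨K, L, hK, hL, hLK, rfl⟩ := hv
  exact List.mem_map.mpr ⟨(K, L), gfdExcluded3_sound h hK hL hLK ha hb hc hd, rfl⟩

/-- Empty list: no `d = 3` member lies in the box. -/
theorem not_mem_gfdFamily3_of_gfdExcluded3 {Kmax : ℕ} {a b c d : ℚ}
    (h : gfdExcluded3 Kmax a b c d [] = true) {v : ℚ × ℚ} (ha : a ≤ v.1) (hb : v.1 ≤ b)
    (hc : c ≤ v.2) (hd : v.2 ≤ d) : v ∉ gfdFamily3 :=
  fun hv => by simpa using mem_map_of_gfdExcluded3 h hv ha hb hc hd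

/-- Real-number form of the `d = 3` sentence. -/
theorem ne_gfd3_of_gfdExcluded3 {Kmax : ℕ} {a b c d : ℚ} {ex : List (ℕ × ℕ)}
    (h : gfdExcluded3 Kmax a b c d ex = true) {x y : ℝ} (hx : (a : ℝ) ≤ x ∧ x ≤ b)
    (hy : (c : ℝ) ≤ y ∧ y ≤ d) {K L : ℕ} (hK : 3 ≤ K) (hL : 1 ≤ L) (hLK : L + 2 ≤ K)
    (hex : (K, L) ∉ ex) :
    (x, y) ≠ (((gfdPair3 K L).1 : ℝ), ((gfdPair3 K L).2 : ℝ)) := by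
  intro e
  have ex1 : x = ((gfdPair3 K L).1 : ℝ) := congrArg Prod.fst e
  have ey1 : y = ((gfdPair3 K L).2 : ℝ) := congrArg Prod.snd e
  rw [ex1] at hx
  rw [ey1] at hy
  exact hex (gfdExcluded3_sound h hK hL hLK (by exact_mod_cast hx.1) (by exact_mod_cast hx.2)
    (by exact_mod_cast hy.1) (by exact_mod_cast hy.2))

/-- **Soundness, `d = 2`.** -/
theorem gfdExcluded2_sound {Kmax : ℕ} {a b c d : ℚ} {ex : List (ℕ × ℕ)}
    (h : gfdExcluded2 Kmax a b c d ex = true) {K L : ℕ} (hK : 3 ≤ K) (hL : 1 ≤ L) (hLK : L + 2 ≤ K)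
    (ha : a ≤ (gfdPair2 K L).1) (hb : (gfdPair2 K L).1 ≤ b) (hc : c ≤ (gfdPair2 K L).2)
    (hd : (gfdPair2 K L).2 ≤ d) : (K, L) ∈ ex := by
  unfold gfdExcluded2 at h
  rw [Bool.and_eq_true, decide_eq_true_eq] at h
  obtain ⟨hKm, hcore⟩ := h
  have hD2 : 0 < K := by omega
  have e1 : (gfdPair2 K L).1 = (((1 : ℕ) : ℤ) : ℚ) / ((K : ℕ) : ℚ) := by
    simp only [gfdPair2]; push_cast; ring
  have e2 : (gfdPair2 K L).2 = (((2 * L : ℕ) : ℤ) : ℚ) / ((K : ℕ) : ℚ) := by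
    simp only [gfdPair2]; push_cast; ring
  have hKle : K ≤ Kmax := by
    by_contra hlt
    have hlt' : ((Kmax + 1 : ℕ) : ℚ) ≤ K := by exact_mod_cast (show Kmax + 1 ≤ K by omega)
    have hKpos : (0 : ℚ) < ((Kmax + 1 : ℕ) : ℚ) := by positivity
    have hpos : 0 < Kmax + 1 := by omega
    have ha' : (((1 : ℕ) : ℤ) : ℚ) / ((Kmax + 1 : ℕ) : ℚ) < a := by
      rw [← not_le, le_intDiv_iff a _ hpos, not_le]
      simpa using hKm
    have hmono : 1 / (K : ℚ) ≤ 1 / ((Kmax + 1 : ℕ) : ℚ) :=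
      one_div_le_one_div_of_le hKpos hlt'
    have e : (1 : ℚ) / ((Kmax + 1 : ℕ) : ℚ) = (((1 : ℕ) : ℤ) : ℚ) / ((Kmax + 1 : ℕ) : ℚ) := by
      push_cast; ring
    rw [e] at hmono
    have hlt2 : (gfdPair2 K L).1 < a := lt_of_le_of_lt hmono ha'
    exact absurd ha (not_le.mpr hlt2)
  unfold gfdCore2 at hcore
  have h1 := List.all_eq_true.mp hcore K (List.mem_range'_1.mpr ⟨hK, by omega⟩)
  have h2 := List.all_eq_true.mp h1 L (List.mem_range'_1.mpr ⟨hL, by omega⟩)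
  rw [e1] at ha hb
  rw [e2] at hc hd
  exact listed_of_orNot h2 (decide_eq_true ((le_intDiv_iff a _ hD2).mp ha))
    (decide_eq_true ((intDiv_le_iff b _ hD2).mp hb)) (decide_eq_true ((le_intDiv_iff c _ hD2).mp hc))
    (decide_eq_true ((intDiv_le_iff d _ hD2).mp hd))

/-! ### Bridge from the floor's statement (`d = 3`) and rule R3 -/

/-- **`GFD` sentence (joint, kind `DeltaPair`).** If `IsingEnclosure W R`, the region `R` lies in the
rational box `[a, b] × [c, d]`, and `gfdExcluded3 Kmax a b c d ex = true`, then no `σ–ε` datum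
satisfying the bootstrap axioms with `(Δ_σ, Δ_ε) ∈ W` sits at a member `((K+1)/(2K), (K+L)/K)` of
Kaupužs' table outside the index list `ex` — "no pair of Kaupužs' possible exact values (any
`m ≥ 1`, `j ≥ −m`) at the certified `(Δ_σ, Δ_ε)`, except …". -/
theorem pair_not_gfd_of_isingEnclosure {W R : Set (ℝ × ℝ)} (h : IsingEnclosure W R)
    {a b c d : ℚ}
    (hR : ∀ q ∈ R, ((a : ℝ) ≤ q.1 ∧ q.1 ≤ (b : ℝ)) ∧ ((c : ℝ) ≤ q.2 ∧ q.2 ≤ (d : ℝ)))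
    {Kmax : ℕ} {ex : List (ℕ × ℕ)} (hx : gfdExcluded3 Kmax a b c d ex = true)
    (D : SigmaEpsilonData) (hD : D.SatisfiesBootstrapAxioms) (hW : (D.Δσ, D.Δε) ∈ W)
    {K L : ℕ} (hK : 3 ≤ K) (hL : 1 ≤ L) (hLK : L + 2 ≤ K) (hex : (K, L) ∉ ex) :
    (D.Δσ, D.Δε) ≠ (((gfdPair3 K L).1 : ℝ), ((gfdPair3 K L).2 : ℝ)) :=
  ne_gfd3_of_gfdExcluded3 hx (hR _ (h D hD hW)).1 (hR _ (h D hD hW)).2 hK hL hLK hex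

/-- **Refinement (rule R3).** A complete index list on `[a, b] × [c, d]` gives the complete list on any
sub-box as a `List.filter` (no re-scan). -/
theorem gfd3_listed_of_subbox {Kmax : ℕ} {a b c d : ℚ} {ex : List (ℕ × ℕ)}
    (h : gfdExcluded3 Kmax a b c d ex = true) {a' b' c' d' : ℚ} (ha : a ≤ a') (hb : b' ≤ b)
    (hc : c ≤ c') (hd : d' ≤ d) {K L : ℕ} (hK : 3 ≤ K) (hL : 1 ≤ L) (hLK : L + 2 ≤ K)
    (h1 : a' ≤ (gfdPair3 K L).1) (h2 : (gfdPair3 K L).1 ≤ b') (h3 : c' ≤ (gfdPair3 K L).2)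
    (h4 : (gfdPair3 K L).2 ≤ d') :
    (K, L) ∈ ex.filter fun e => decide (a' ≤ (gfdPair3 e.1 e.2).1 ∧ (gfdPair3 e.1 e.2).1 ≤ b' ∧
      c' ≤ (gfdPair3 e.1 e.2).2 ∧ (gfdPair3 e.1 e.2).2 ≤ d') := by
  rw [List.mem_filter, decide_eq_true_eq]
  exact ⟨gfdExcluded3_sound h hK hL hLK (le_trans ha h1) (le_trans h2 hb) (le_trans hc h3)
    (le_trans h4 hd), h1, h2, h3, h4⟩

end Summit.CriticalPhenomena.Ising3D
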